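import Summits.Ventures.YMGap.Thresholds.TorusStateResponseBoundDim
import HarnessLib

/-!
# Venture YMGap — C-LIP AT THE STAR WINDOW IN EVERY DIMENSION: the `SU(N)` strong-coupling state on `ℤ^d` is Lipschitz in
# the coupling (hypothesis-free for `N ≥ 2`, `d ≥ 2` at 't Hooft `(d−1)·b/N ≤ 1/12`)

HONEST FRAMING: venture file of the cell `pub-ymgap` (QuantumFields programme), seat ds-1; general-`d` form of
`TorusStateResponseBoundSUN` §4.  Strong-coupling LATTICE statements for `SU(N)` lattice Yang–Mills on `ℤ^d`, Wilson
action at tree coupling `b`, inside the one-sided vertex-star window generated by `OneLinkKRModulus N R K`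
(`2(d−1) b₁/N ≤ R`, door `P_d(K b₁/N) < 1`); Lipschitz statements in the coupling; nothing about the continuum or Clay.

* `abs_integral_torusState_sub_le_dim` — the torus state is Lipschitz in `b` on `[0, b₁]`, uniformly in `L > 4D + 4`
  (mean value theorem on `hasDerivAt_integral_torusState_SU`, bound `abs_responseSum_torusState_le_dim`);
* `abs_integral_sub_integral_le_star_dim` — C-LIP at the star window on `ℤ^d` for the (unique) DLR states;
* `bakryEmery_door_dim` — the Bakry–Émery door: `b₁ = N/(12(d−1))`, `K = 3`, `P_d(1/(4(d−1))) = 1 − 1/(4(d−1)) < 1`;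
* ★ `abs_integral_sub_integral_le_dim_thooft` — every `N ≥ 2`, every `d ≥ 2`, HYPOTHESIS-FREE, at
  `0 ≤ (d−1)b/N, (d−1)b'/N ≤ 1/12` (printed Shen–Zhu–Zhu window `1/(16(d−1))`).

References (mechanism only): R. L. Dobrushin, S. B. Shlosman (1985); H. Shen, R. Zhu, X. Zhu, CMP 400 (2023) Lemma 4.1.
-/

noncomputable section

open MeasureTheory ProbabilityTheory Function Finset Filter Topology Real
open scoped NNReal
open Literature.Probability.LatticeModels (Torus.proj Torus.proj_apply HasUniqueGibbsMeasure)
open Literature.MathematicalPhysics.QuantumLattice (LGConfig ZdEdge ZdPlaquette plaquetteEdges torusLift torusEdge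
  toTorusObservable toTorusObservable_apply fundamentalRep continuous_fundamentalRep ymSpecification ymGibbsMeasures)
open Literature.MathematicalPhysics.QuantumFieldTheory hiding ZdEdge
open Literature.MathematicalPhysics.QuantumFieldTheory.Balaban1983to89.StrongCouplingTorusWindow
open Literature.MathematicalPhysics.QuantumFieldTheory.Balaban1983to89.StrongCouplingDobrushinWindow (OneLinkKRModulus)
open Literature.MathematicalPhysics.QuantumFieldTheory.Balaban1983to89.StrongCouplingKernelWindow (oneLinkKRModulus_SU)
open Summit.Ventures.YMGap.DSWindow (linkEnds vertexStar starWin IsLinkWindowContraction)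
open Summit.Ventures.YMGap.StarResolventDim (Delta gaugeR doorPoly Delta_pos_of_door doorPoly_lt_one_mono gaugeR_lt_one_of_door)
open Summit.Ventures.YMGap.StarLimit (continuous_of_isLipschitzCylinder)
open Summit.Ventures.YMGap.RobustBall (l1 l1_sub_comm numOrient sum_pow_l1_sub_le)
open Summit.Ventures.YMGap.PlaquetteSusceptibility (l1_le_mul_norm)

namespace Summit.Ventures.YMGap.CouplingResponse

variable {d N : ℕ}

/-! ### §4 The torus state and the DLR state are Lipschitz in the coupling (general `d`) -/

section Lipschitz

/-- **The `SU(N)` torus state on `(ℤ/L)^d` is Lipschitz in the coupling, uniformly in `L > 4D + 4`**, on `[0, b₁]`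
(mean value theorem on `hasDerivAt_integral_torusState_SU`, bound `abs_responseSum_torusState_le_dim`, windows
`star_window_uniform_dim`). [folklore] -/
theorem abs_integral_torusState_sub_le_dim {L : ℕ} [NeZero L] (hd : 2 ≤ d) (hN : 1 ≤ N) {R K b₁ : ℝ} (hK0 : 0 ≤ K)
    (hmod : OneLinkKRModulus N R K) (hR : b₁ / N * (2 * ((d : ℝ) - 1)) ≤ R) (hdoor : doorPoly d (K * (b₁ / N)) < 1)
    {F : LGConfig d (Matrix.specialUnitaryGroup (Fin N) ℂ) → ℝ} {Λ : Finset (ZdEdge d)} {KF : ℝ≥0}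
    (hF : IsLipschitzCylinder (fundamentalRep (Fin N)) F Λ KF)
    {x₀ : Literature.Probability.LatticeModels.Site d} {D : ℕ} (hD : ∀ e ∈ Λ, ‖e.1 - x₀‖ ≤ D) (hL : 4 * D + 4 < L)
    {b b' : ℝ} (h0 : 0 ≤ b) (hb : b ≤ b₁) (h0' : 0 ≤ b') (hb' : b' ≤ b₁) :
    |(∫ U, F U ∂(torusState (d := d) (fundamentalRep (Fin N)) b L)) -
        ∫ U, F U ∂(torusState (d := d) (fundamentalRep (Fin N)) b' L)| ≤
      N * (numOrient d * (4 * (2 * Real.sqrt N) ^ 2 *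
        Real.exp (((1 - gaugeR d (K * (b₁ / N))) ^ 2 / (2 * (2 * gaugeR d (K * (b₁ / N)) * ((2 * d : ℕ) : ℝ) + 1))) * (D + 3)) *
        ((Λ.card : ℝ) * KF) * (16 * (N : ℝ) ^ 3) *
        ((1 + Real.exp (-(((1 - gaugeR d (K * (b₁ / N))) ^ 2 / (2 * (2 * gaugeR d (K * (b₁ / N)) * ((2 * d : ℕ) : ℝ) + 1))) / d))) /
          (1 - Real.exp (-(((1 - gaugeR d (K * (b₁ / N))) ^ 2 / (2 * (2 * gaugeR d (K * (b₁ / N)) * ((2 * d : ℕ) : ℝ) + 1))) / d)))) ^ d)) *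
        |b - b'| := by
  classical
  haveI : SecondCountableTopology (Matrix (Fin N) (Fin N) ℂ) :=
    inferInstanceAs (SecondCountableTopology (Fin N → Fin N → ℂ))
  haveI : SecondCountableTopology (Matrix.specialUnitaryGroup (Fin N) ℂ) :=
    Topology.IsEmbedding.subtypeVal.secondCountableTopology
  have hN0 : (0 : ℝ) < N := by exact_mod_cast (show 0 < N by omega)
  set ρ := gaugeR d (K * (b₁ / N)) with hρ
  have hb₁N : 0 ≤ b₁ / N := div_nonneg (h0.trans hb) hN0.le
  obtain ⟨hρ0, hρ1⟩ := gaugeR_dim_coef_lt_one (N := N) hd hK0 hb₁N hdoor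
  obtain ⟨s, hs, hcen, -⟩ := exists_centredLift L x₀ (d := d)
  set B : ℝ := N * (numOrient d * (4 * (2 * Real.sqrt N) ^ 2 *
    Real.exp (((1 - ρ) ^ 2 / (2 * (2 * ρ * ((2 * d : ℕ) : ℝ) + 1))) * (D + 3)) * ((Λ.card : ℝ) * KF) * (16 * (N : ℝ) ^ 3) *
    ((1 + Real.exp (-(((1 - ρ) ^ 2 / (2 * (2 * ρ * ((2 * d : ℕ) : ℝ) + 1))) / d))) /
      (1 - Real.exp (-(((1 - ρ) ^ 2 / (2 * (2 * ρ * ((2 * d : ℕ) : ℝ) + 1))) / d)))) ^ d)) with hB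
  set φ : ℝ → ℝ := fun t => ∫ U, F U ∂(torusState (d := d) (fundamentalRep (Fin N)) t L) with hφ
  have hFb : ∀ U, |F U| ≤ |F 1| + 2 * KF := fun U => hF.abs_le U
  have hderiv : ∀ t ∈ Set.Icc (0 : ℝ) b₁, HasDerivWithinAt φ
      (∑ y : Site d L, ∑ p : {p : Fin d × Fin d // p.1 < p.2},
        (N : ℝ) * cov[F, zdPlaquetteObs (fundamentalRep (Fin N)) (s y) p.1.1 p.1.2;
          torusState (d := d) (fundamentalRep (Fin N)) t L]) (Set.Icc (0 : ℝ) b₁) t :=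
    fun t _ => (hasDerivAt_integral_torusState_SU (d := d) (N := N) hF.measurable hFb hs t).hasDerivWithinAt
  have hbound : ∀ t ∈ Set.Icc (0 : ℝ) b₁,
      ‖∑ y : Site d L, ∑ p : {p : Fin d × Fin d // p.1 < p.2},
        (N : ℝ) * cov[F, zdPlaquetteObs (fundamentalRep (Fin N)) (s y) p.1.1 p.1.2;
          torusState (d := d) (fundamentalRep (Fin N)) t L]‖ ≤ B := by
    intro t ht
    have hWt := star_window_uniform_dim (L := L) hd (by omega) hN hK0 hmod hR hdoor ht.1 ht.2
    rw [Real.norm_eq_abs]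
    exact abs_responseSum_torusState_le_dim hd t hρ0 hρ1 hWt hF hD hL hs hcen
  have hmv := (convex_Icc (0 : ℝ) b₁).norm_image_sub_le_of_norm_hasDerivWithin_le hderiv hbound
    (show b' ∈ Set.Icc (0 : ℝ) b₁ from ⟨h0', hb'⟩) (show b ∈ Set.Icc (0 : ℝ) b₁ from ⟨h0, hb⟩)
  rw [Real.norm_eq_abs, Real.norm_eq_abs] at hmv
  exact hmv

/-- **C-LIP AT THE STAR WINDOW in every dimension, every `SU(N)`** (`N ≥ 1`, `d ≥ 2`): under `OneLinkKRModulus N R K`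
(`K ≥ 0`), `2(d−1) b₁/N ≤ R`, `P_d(K b₁/N) < 1`, for all `0 ≤ b, b' ≤ b₁`, the (unique) DLR states `μ` at `b` and `ν` at
`b'`, and every Lipschitz cylinder `F`: `|∫F dμ − ∫F dν| ≤ N · D_d · A_{N,d} ((1+r)/(1−r))^d · |b − b'|`. [folklore] -/
theorem abs_integral_sub_integral_le_star_dim (hd : 2 ≤ d) (hN : 1 ≤ N) {R K b₁ : ℝ} (hK0 : 0 ≤ K)
    (hmod : OneLinkKRModulus N R K) (hR : b₁ / N * (2 * ((d : ℝ) - 1)) ≤ R) (hdoor : doorPoly d (K * (b₁ / N)) < 1)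
    {b b' : ℝ} (h0 : 0 ≤ b) (hb : b ≤ b₁) (h0' : 0 ≤ b') (hb' : b' ≤ b₁)
    {μ ν : Measure (LGConfig d (Matrix.specialUnitaryGroup (Fin N) ℂ))}
    (hμ : μ ∈ ymGibbsMeasures (d := d) (fundamentalRep (Fin N)) b)
    (hν : ν ∈ ymGibbsMeasures (d := d) (fundamentalRep (Fin N)) b')
    {F : LGConfig d (Matrix.specialUnitaryGroup (Fin N) ℂ) → ℝ} {Λ : Finset (ZdEdge d)} {KF : ℝ≥0}
    (hF : IsLipschitzCylinder (fundamentalRep (Fin N)) F Λ KF)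
    {x₀ : Literature.Probability.LatticeModels.Site d} {D : ℕ} (hD : ∀ e ∈ Λ, ‖e.1 - x₀‖ ≤ D) :
    |(∫ U, F U ∂μ) - ∫ U, F U ∂ν| ≤
      N * (numOrient d * (4 * (2 * Real.sqrt N) ^ 2 *
        Real.exp (((1 - gaugeR d (K * (b₁ / N))) ^ 2 / (2 * (2 * gaugeR d (K * (b₁ / N)) * ((2 * d : ℕ) : ℝ) + 1))) * (D + 3)) *
        ((Λ.card : ℝ) * KF) * (16 * (N : ℝ) ^ 3) *
        ((1 + Real.exp (-(((1 - gaugeR d (K * (b₁ / N))) ^ 2 / (2 * (2 * gaugeR d (K * (b₁ / N)) * ((2 * d : ℕ) : ℝ) + 1))) / d))) /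
          (1 - Real.exp (-(((1 - gaugeR d (K * (b₁ / N))) ^ 2 / (2 * (2 * gaugeR d (K * (b₁ / N)) * ((2 * d : ℕ) : ℝ) + 1))) / d)))) ^ d)) *
        |b - b'| := by
  haveI : SecondCountableTopology (Matrix (Fin N) (Fin N) ℂ) :=
    inferInstanceAs (SecondCountableTopology (Fin N → Fin N → ℂ))
  haveI : SecondCountableTopology (Matrix.specialUnitaryGroup (Fin N) ℂ) :=
    Topology.IsEmbedding.subtypeVal.secondCountableTopology
  have hFc : Continuous F := continuous_of_isLipschitzCylinder hF
  have hFb : ∀ U, |F U| ≤ |F 1| + 2 * KF := fun U => hF.abs_le U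
  have tμ := tendsto_integral_torusState_of_subsingleton (d := d) (fundamentalRep (Fin N))
    (continuous_fundamentalRep (Fin N)) (hasUniqueGibbsMeasure_of_modulus_dim hd hN hK0 hmod hR hdoor h0 hb).1 hμ hFc hFb
  have tν := tendsto_integral_torusState_of_subsingleton (d := d) (fundamentalRep (Fin N))
    (continuous_fundamentalRep (Fin N)) (hasUniqueGibbsMeasure_of_modulus_dim hd hN hK0 hmod hR hdoor h0' hb').1 hν hFc hFb
  refine le_of_tendsto (tμ.sub tν).abs ?_
  filter_upwards [Filter.eventually_ge_atTop (4 * D + 4)] with L hL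
  exact abs_integral_torusState_sub_le_dim (L := L + 1) hd hN hK0 hmod hR hdoor hF hD (by omega) h0 hb h0' hb'

/-- The Bakry–Émery door in dimension `d`: with `b₁ = N/(12(d−1))`, `R = 2(d−1)b₁/N = 1/6`, `K = 1/(1/2 − R) = 3`, the
coefficient `c = K b₁/N = 1/(4(d−1))` satisfies `P_d(c) = 1 − 1/(4(d−1)) < 1`. [folklore] -/
theorem bakryEmery_door_dim (hd : 2 ≤ d) (hN : 1 ≤ N) :
    (N : ℝ) / (12 * ((d : ℝ) - 1)) / N * (2 * ((d : ℝ) - 1)) < 1 / 2 ∧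
      0 ≤ 1 / (1 / 2 - (N : ℝ) / (12 * ((d : ℝ) - 1)) / N * (2 * ((d : ℝ) - 1))) ∧
      doorPoly d (1 / (1 / 2 - (N : ℝ) / (12 * ((d : ℝ) - 1)) / N * (2 * ((d : ℝ) - 1))) *
        ((N : ℝ) / (12 * ((d : ℝ) - 1)) / N)) < 1 := by
  have hN0 : (0 : ℝ) < N := by exact_mod_cast (show 0 < N by omega)
  have hd' : (2 : ℝ) ≤ d := by exact_mod_cast hd
  have he : (0 : ℝ) < (d : ℝ) - 1 := by linarith
  have hx : (N : ℝ) / (12 * ((d : ℝ) - 1)) / N = 1 / (12 * ((d : ℝ) - 1)) := by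
    field_simp
  rw [hx]
  have h16 : 1 / (12 * ((d : ℝ) - 1)) * (2 * ((d : ℝ) - 1)) = 1 / 6 := by
    field_simp; ring
  rw [h16]
  refine ⟨by norm_num, by norm_num, ?_⟩
  have hK : (1 : ℝ) / (1 / 2 - 1 / 6) = 3 := by norm_num
  rw [hK]
  unfold doorPoly
  have hc : (3 : ℝ) * (1 / (12 * ((d : ℝ) - 1))) = 1 / (4 * ((d : ℝ) - 1)) := by
    field_simp; ring
  rw [hc]
  have h4 : (0 : ℝ) < 4 * ((d : ℝ) - 1) := by linarith
  rw [div_pow, one_pow, show (4 * (d : ℝ) - 4) = 4 * ((d : ℝ) - 1) by ring,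
    show (4 * ((d : ℝ) - 1)) ^ 2 = (4 * ((d : ℝ) - 1)) * (4 * ((d : ℝ) - 1)) by ring]
  rw [show 4 * ((d : ℝ) - 1) * (1 / (4 * ((d : ℝ) - 1) * (4 * ((d : ℝ) - 1)))) = 1 / (4 * ((d : ℝ) - 1)) by
    field_simp]
  rw [show (4 * (d : ℝ) - 6) * (1 / (4 * ((d : ℝ) - 1))) = 1 - 2 / (4 * ((d : ℝ) - 1)) by field_simp; ring]
  have : (0 : ℝ) < 1 / (4 * ((d : ℝ) - 1)) := by positivity
  have h2 : (2 : ℝ) / (4 * ((d : ℝ) - 1)) = 2 * (1 / (4 * ((d : ℝ) - 1))) := by ring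
  rw [h2]; linarith

/-- ★ **C-LIP AT THE STAR WINDOW FOR EVERY `SU(N)`, `N ≥ 2`, IN EVERY DIMENSION `d ≥ 2`, HYPOTHESIS-FREE** (Bakry–Émery
modulus `oneLinkKRModulus_SU`): for all tree couplings `0 ≤ b, b'` with `(d−1)·b/N, (d−1)·b'/N ≤ 1/12` the DLR states are
Lipschitz in the coupling on every Lipschitz cylinder observable (printed Shen–Zhu–Zhu window: `1/(16(d−1))`). [folklore] -/
theorem abs_integral_sub_integral_le_dim_thooft (hd : 2 ≤ d) (hN : 2 ≤ N) {b b' : ℝ} (h0 : 0 ≤ b)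
    (hb : b / N * ((d : ℝ) - 1) ≤ 1 / 12) (h0' : 0 ≤ b') (hb' : b' / N * ((d : ℝ) - 1) ≤ 1 / 12)
    {μ ν : Measure (LGConfig d (Matrix.specialUnitaryGroup (Fin N) ℂ))}
    (hμ : μ ∈ ymGibbsMeasures (d := d) (fundamentalRep (Fin N)) b)
    (hν : ν ∈ ymGibbsMeasures (d := d) (fundamentalRep (Fin N)) b')
    {F : LGConfig d (Matrix.specialUnitaryGroup (Fin N) ℂ) → ℝ} {Λ : Finset (ZdEdge d)} {KF : ℝ≥0}
    (hF : IsLipschitzCylinder (fundamentalRep (Fin N)) F Λ KF)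
    {x₀ : Literature.Probability.LatticeModels.Site d} {D : ℕ} (hD : ∀ e ∈ Λ, ‖e.1 - x₀‖ ≤ D) :
    ∃ C : ℝ, |(∫ U, F U ∂μ) - ∫ U, F U ∂ν| ≤ C * |b - b'| ∧
      C = N * (numOrient d * (4 * (2 * Real.sqrt N) ^ 2 *
        Real.exp (((1 - gaugeR d (3 * (1 / (12 * ((d : ℝ) - 1))))) ^ 2 /
          (2 * (2 * gaugeR d (3 * (1 / (12 * ((d : ℝ) - 1)))) * ((2 * d : ℕ) : ℝ) + 1))) * (D + 3)) *
        ((Λ.card : ℝ) * KF) * (16 * (N : ℝ) ^ 3) *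
        ((1 + Real.exp (-(((1 - gaugeR d (3 * (1 / (12 * ((d : ℝ) - 1))))) ^ 2 /
          (2 * (2 * gaugeR d (3 * (1 / (12 * ((d : ℝ) - 1)))) * ((2 * d : ℕ) : ℝ) + 1))) / d))) /
          (1 - Real.exp (-(((1 - gaugeR d (3 * (1 / (12 * ((d : ℝ) - 1))))) ^ 2 /
          (2 * (2 * gaugeR d (3 * (1 / (12 * ((d : ℝ) - 1)))) * ((2 * d : ℕ) : ℝ) + 1))) / d)))) ^ d)) := by
  have hN0 : (0 : ℝ) < N := by exact_mod_cast (show 0 < N by omega)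
  have hd' : (2 : ℝ) ≤ d := by exact_mod_cast hd
  have he : (0 : ℝ) < (d : ℝ) - 1 := by linarith
  set b₁ : ℝ := (N : ℝ) / (12 * ((d : ℝ) - 1)) with hb₁
  obtain ⟨h1, hK0, hdoor⟩ := bakryEmery_door_dim (N := N) hd (by omega)
  have hmod := oneLinkKRModulus_SU hN h1
  have hx : (N : ℝ) / (12 * ((d : ℝ) - 1)) / N = 1 / (12 * ((d : ℝ) - 1)) := by field_simp
  have hK : 1 / (1 / 2 - (N : ℝ) / (12 * ((d : ℝ) - 1)) / N * (2 * ((d : ℝ) - 1))) = 3 := by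
    rw [hx]
    have h16 : 1 / (12 * ((d : ℝ) - 1)) * (2 * ((d : ℝ) - 1)) = 1 / 6 := by field_simp; ring
    rw [h16]; norm_num
  have hbb : b ≤ b₁ := by
    rw [hb₁, le_div_iff₀ (by positivity)]
    have := (div_le_iff₀ hN0).1 (show b * ((d : ℝ) - 1) / N ≤ 1 / 12 by rw [div_mul_eq_mul_div] at hb; exact hb)
    nlinarith
  have hbb' : b' ≤ b₁ := by
    rw [hb₁, le_div_iff₀ (by positivity)]
    have := (div_le_iff₀ hN0).1 (show b' * ((d : ℝ) - 1) / N ≤ 1 / 12 by rw [div_mul_eq_mul_div] at hb'; exact hb')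
    nlinarith
  have key := abs_integral_sub_integral_le_star_dim hd (by omega) hK0 hmod le_rfl hdoor h0 hbb h0' hbb' hμ hν hF hD
  rw [hK, hx] at key
  exact ⟨_, key, rfl⟩

end Lipschitz

end Summit.Ventures.YMGap.CouplingResponse

end
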